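import Mathlib
import Summits.Ventures.PercRepro2.Defs
import Summits.Ventures.PercRepro2.Harris
import Summits.Ventures.PercRepro2.Graph
import Summits.Ventures.PercRepro2.Exploration
import Summits.Ventures.PercRepro2.Events
import Summits.Ventures.PercRepro2.CutVertexDefs
import Summits.Ventures.PercRepro2.CDCutVertex
import Summits.Ventures.PercRepro2.TCutVertex

/-!
# (T_h) across a cut vertex with ONE ARBITRARY up-set — the tower over the near side
(blind cell PercRepro2, mine-a g46; MINE-A.md §101.5 (i))

Cut vertex `x` (`CutV.IsCut ends x VA VB EA EB`), root `s ∈ VA`, hit vertex `h ∈ VB`, the up-set `𝓥`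
read beyond the cut (`S ∈ 𝓥 ↔ S ∩ VB ∈ 𝓥`, `∅ ∉ 𝓥`) and the up-set `𝓤` ARBITRARY.  Condition on the
near-side configuration `T = restrict EA ω` (`CDCutVertex.prob_eq_sum_tower`): on `{s ↔ x inside A}`
the cluster of `s` is `C_A(s)(T) ∪ C_B(x)` and `U` is the far-side cluster event of the up-set
`𝓤_T := {W ∣ C_A(s)(T) ∪ W ∈ 𝓤}`; off it, `U = {C_A(s) ∈ 𝓤}` is a near-side event.  Because `Q` and
`e` are pure far-side events (their near-side part is `{s ↔ x}` alone), every product of the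
(T)-form is LINEAR in the near-side masses, and with `ξ = P_A(s ↔ x)`, `U_A = {C_s ∈ 𝓤}` read on the
near side,

  **`T(p; s, h; 𝓤, 𝓥) = Σ_ω w(ω)·1_{s ↔ x}(T)·[(1 − ξ)·P_B(Q_B ∩ U_{𝓤_T} ∩ e_B) + ξ·T_B(𝓤_T, 𝓥)]
      − ξ·P_B(Q_B ∩ e_B)·P_A({s ↮ x} ∩ U_A)`**   (`t_cut_tower_identity`)

— no two-up-set cross form ever appears.  The terms with `C_A(s)(T) ∈ 𝓤` have `𝓤_T = univ` and
`T_B = 0`, and they combine with the last term into `P_B(Q_B ∩ e_B)·Cov_A({s ↔ x}, U_A) ≥ 0` (Harris);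
hence (T_h) on `G` follows from the far-side (T)-inequality for the up-sets `𝓤_T` of the near
configurations with `s ↔ x` and `C_A(s)(T) ∉ 𝓤` (`t_of_cut_tower`).  Exact check in Fractions on 28
random glued multigraphs with arbitrary `𝓤`, 0 mismatches (data/mine-a/g46/codes).  No definition;
one seat.
-/

namespace Summit.Ventures.PercRepro2

namespace TCutVertexTower

open CutV

variable {V : Type*} {E : Type*} [Fintype E] [DecidableEq E]
  {R : Type*} [Field R] [LinearOrder R] [IsStrictOrderedRing R]
variable {ends : E → Sym2 V} {x : V} {VA VB : Set V} {EA EB : Set E}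
  [DecidablePred (· ∈ EA)] [DecidablePred (· ∈ EB)]

/-! ## The far-side up-set of a near configuration, and the seven events -/
section Events

omit [Fintype E] [DecidableEq E] [Field R] [LinearOrder R] [IsStrictOrderedRing R] in
/-- On `{s ↔ x inside A}`, `C_s ∈ 𝓤` iff the far-side cluster of `x` lies in `𝓤_T`. -/
lemma mem_U_of_conn (h : IsCut ends x VA VB EA EB) {s : V} (hs : s ∈ VA) (𝓤 : Set (Set V))
    {ω : Config E} (hx : Conn ends (restrict EA ω) s x) :
    ω ∈ clusterInEvent ends s 𝓤 ↔
      restrict EB ω ∈ clusterInEvent ends x {W : Set V | cluster ends (restrict EA ω) s ∪ W ∈ 𝓤} := by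
  simp only [mem_clusterInEvent, Set.mem_setOf_eq]
  rw [cluster_eq_union h hs hx]

omit [Fintype E] [DecidableEq E] [Field R] [LinearOrder R] [IsStrictOrderedRing R] in
/-- Off `{s ↔ x inside A}`, `C_s ∈ 𝓤` iff the near-side cluster lies in `𝓤`. -/
lemma mem_U_of_not_conn (h : IsCut ends x VA VB EA EB) {s : V} (hs : s ∈ VA) (𝓤 : Set (Set V))
    {ω : Config E} (hx : ¬ Conn ends (restrict EA ω) s x) :
    ω ∈ clusterInEvent ends s 𝓤 ↔ restrict EA ω ∈ clusterInEvent ends s 𝓤 := by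
  simp only [mem_clusterInEvent]
  rw [cluster_eq_of_not_conn h hs hx]

end Events

/-! ## The tower identity -/
section Main

omit [LinearOrder R] [IsStrictOrderedRing R] in
/-- A near-side indicator sum is a near-side probability. -/
lemma sum_weight_indicator (p : E → R) (S : Set (Config E)) :
    ∑ ω, weight p ω * S.indicator (1 : Config E → R) (restrict EA ω) = prob p (sideEvent EA S) := by
  rw [prob_eq_expect_indicator]
  unfold expect
  refine Finset.sum_congr rfl fun ω _ => ?_
  congr 1

omit [LinearOrder R] [IsStrictOrderedRing R] in
/-- **The (T)-form across the cut, `𝓥` beyond and `𝓤` arbitrary, as a tower over the near side.** -/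
theorem t_cut_tower_identity (p : E → R) (h : IsCut ends x VA VB EA EB) {s hv : V} (hs : s ∈ VA)
    (hvB : hv ∈ VB) (𝓤 : Set (Set V)) {𝓥 : Set (Set V)} (h𝓥 : ∀ S, S ∈ 𝓥 ↔ S ∩ VB ∈ 𝓥)
    (h𝓥0 : ∅ ∉ 𝓥) :
    prob p (clusterInEvent ends s {T : Set V | hv ∈ T} ∩ clusterInEvent ends s 𝓤 ∩ clusterInEvent ends s 𝓥) + prob p (clusterInEvent ends s {T : Set V | hv ∈ T}) * prob p (clusterInEvent ends s 𝓤 ∩ clusterInEvent ends s 𝓥) -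
      prob p (clusterInEvent ends s {T : Set V | hv ∈ T} ∩ clusterInEvent ends s 𝓤) * prob p (clusterInEvent ends s 𝓥) - prob p (clusterInEvent ends s {T : Set V | hv ∈ T} ∩ clusterInEvent ends s 𝓥) * prob p (clusterInEvent ends s 𝓤) =
    (∑ ω, weight p ω * ((connEvent ends s x).indicator (1 : Config E → R) (restrict EA ω) *
        ((1 - prob (fun e => if e ∈ EA then p e else 0) (connEvent ends s x)) * prob (fun e => if e ∈ EB then p e else 0) (clusterInEvent ends x {T : Set V | hv ∈ T} ∩ clusterInEvent ends x {W : Set V | cluster ends (restrict EA ω) s ∪ W ∈ 𝓤} ∩ clusterInEvent ends x 𝓥) +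
          prob (fun e => if e ∈ EA then p e else 0) (connEvent ends s x) * (prob (fun e => if e ∈ EB then p e else 0) (clusterInEvent ends x {T : Set V | hv ∈ T} ∩ clusterInEvent ends x {W : Set V | cluster ends (restrict EA ω) s ∪ W ∈ 𝓤} ∩ clusterInEvent ends x 𝓥) + prob (fun e => if e ∈ EB then p e else 0) (clusterInEvent ends x {T : Set V | hv ∈ T}) * prob (fun e => if e ∈ EB then p e else 0) (clusterInEvent ends x {W : Set V | cluster ends (restrict EA ω) s ∪ W ∈ 𝓤} ∩ clusterInEvent ends x 𝓥) - prob (fun e => if e ∈ EB then p e else 0) (clusterInEvent ends x {T : Set V | hv ∈ T} ∩ clusterInEvent ends x {W : Set V | cluster ends (restrict EA ω) s ∪ W ∈ 𝓤}) * prob (fun e => if e ∈ EB then p e else 0) (clusterInEvent ends x 𝓥) - prob (fun e => if e ∈ EB then p e else 0) (clusterInEvent ends x {T : Set V | hv ∈ T} ∩ clusterInEvent ends x 𝓥) * prob (fun e => if e ∈ EB then p e else 0) (clusterInEvent ends x {W : Set V | cluster ends (restrict EA ω) s ∪ W ∈ 𝓤}))))) -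
      prob (fun e => if e ∈ EA then p e else 0) (connEvent ends s x) * prob (fun e => if e ∈ EB then p e else 0) (clusterInEvent ends x {T : Set V | hv ∈ T} ∩ clusterInEvent ends x 𝓥) * prob (fun e => if e ∈ EA then p e else 0) ((connEvent ends s x)ᶜ ∩ clusterInEvent ends s 𝓤) := by
  have mQ : ∀ ω, ω ∈ clusterInEvent ends s {T : Set V | hv ∈ T} ↔
      (restrict EA ω ∈ connEvent ends s x ∧ restrict EB ω ∈ clusterInEvent ends x {T : Set V | hv ∈ T}) := fun ω => by
    rw [TCutVertex.hit_eq (EA := EA) h hs hvB]; exact Iff.rfl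
  have mE : ∀ ω, ω ∈ clusterInEvent ends s 𝓥 ↔
      (restrict EA ω ∈ connEvent ends s x ∧ restrict EB ω ∈ clusterInEvent ends x 𝓥) := fun ω => by
    rw [TCutVertex.clusterInEvent_eq (EA := EA) h hs h𝓥 h𝓥0]; exact Iff.rfl
  have s1 : clusterInEvent ends s {T : Set V | hv ∈ T} ∩ clusterInEvent ends s 𝓤 ∩ clusterInEvent ends s 𝓥 = {ω | restrict EA ω ∈ connEvent ends s x ∧ restrict EB ω ∈ (fun T : Config E => clusterInEvent ends x {T : Set V | hv ∈ T} ∩ clusterInEvent ends x {W : Set V | cluster ends T s ∪ W ∈ 𝓤} ∩ clusterInEvent ends x 𝓥) (restrict EA ω)} := by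
    ext ω
    simp only [Set.mem_inter_iff, Set.mem_setOf_eq]
    by_cases hx : Conn ends (restrict EA ω) s x
    · rw [mQ ω, mE ω, mem_U_of_conn h hs 𝓤 hx]; tauto
    · rw [mQ ω]; exact ⟨fun hh => absurd hh.1.1.1 hx, fun hh => absurd hh.1 hx⟩
  have s2 : clusterInEvent ends s {T : Set V | hv ∈ T} = {ω | restrict EA ω ∈ connEvent ends s x ∧ restrict EB ω ∈ (fun _ : Config E => clusterInEvent ends x {T : Set V | hv ∈ T}) (restrict EA ω)} := by
    ext ω; exact mQ ω
  have s3 : clusterInEvent ends s 𝓤 ∩ clusterInEvent ends s 𝓥 = {ω | restrict EA ω ∈ connEvent ends s x ∧ restrict EB ω ∈ (fun T : Config E => clusterInEvent ends x {W : Set V | cluster ends T s ∪ W ∈ 𝓤} ∩ clusterInEvent ends x 𝓥) (restrict EA ω)} := by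
    ext ω
    simp only [Set.mem_inter_iff, Set.mem_setOf_eq]
    by_cases hx : Conn ends (restrict EA ω) s x
    · rw [mE ω, mem_U_of_conn h hs 𝓤 hx]; tauto
    · rw [mE ω]; exact ⟨fun hh => absurd hh.2.1 hx, fun hh => absurd hh.1 hx⟩
  have s4 : clusterInEvent ends s {T : Set V | hv ∈ T} ∩ clusterInEvent ends s 𝓤 = {ω | restrict EA ω ∈ connEvent ends s x ∧ restrict EB ω ∈ (fun T : Config E => clusterInEvent ends x {T : Set V | hv ∈ T} ∩ clusterInEvent ends x {W : Set V | cluster ends T s ∪ W ∈ 𝓤}) (restrict EA ω)} := by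
    ext ω
    simp only [Set.mem_inter_iff, Set.mem_setOf_eq]
    by_cases hx : Conn ends (restrict EA ω) s x
    · rw [mQ ω, mem_U_of_conn h hs 𝓤 hx]; tauto
    · rw [mQ ω]; exact ⟨fun hh => absurd hh.1.1 hx, fun hh => absurd hh.1 hx⟩
  have s5 : clusterInEvent ends s 𝓥 = {ω | restrict EA ω ∈ connEvent ends s x ∧ restrict EB ω ∈ (fun _ : Config E => clusterInEvent ends x 𝓥) (restrict EA ω)} := by
    ext ω; exact mE ω
  have s6 : clusterInEvent ends s {T : Set V | hv ∈ T} ∩ clusterInEvent ends s 𝓥 = {ω | restrict EA ω ∈ connEvent ends s x ∧ restrict EB ω ∈ (fun _ : Config E => clusterInEvent ends x {T : Set V | hv ∈ T} ∩ clusterInEvent ends x 𝓥) (restrict EA ω)} := by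
    ext ω
    simp only [Set.mem_inter_iff, Set.mem_setOf_eq]
    rw [mQ ω, mE ω]; tauto
  have s7 : clusterInEvent ends s 𝓤 = {ω | restrict EA ω ∈ connEvent ends s x ∧ restrict EB ω ∈ (fun T : Config E => clusterInEvent ends x {W : Set V | cluster ends T s ∪ W ∈ 𝓤}) (restrict EA ω)} ∪ sideEvent EA ((connEvent ends s x)ᶜ ∩ clusterInEvent ends s 𝓤) := by
    ext ω
    simp only [Set.mem_union, Set.mem_setOf_eq, mem_sideEvent, Set.mem_inter_iff, Set.mem_compl_iff]
    by_cases hx : Conn ends (restrict EA ω) s x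
    · rw [mem_U_of_conn h hs 𝓤 hx]
      exact ⟨fun hh => Or.inl ⟨hx, hh⟩, fun hh => hh.elim (fun hh => hh.2) (fun hh => absurd hx hh.1)⟩
    · rw [mem_U_of_not_conn h hs 𝓤 hx]
      exact ⟨fun hh => Or.inr ⟨hx, hh⟩, fun hh => hh.elim (fun hh => absurd hh.1 hx) (fun hh => hh.2)⟩
  have hdisj7 : Disjoint {ω | restrict EA ω ∈ connEvent ends s x ∧ restrict EB ω ∈ (fun T : Config E => clusterInEvent ends x {W : Set V | cluster ends T s ∪ W ∈ 𝓤}) (restrict EA ω)} (sideEvent EA ((connEvent ends s x)ᶜ ∩ clusterInEvent ends s 𝓤)) := by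
    rw [Set.disjoint_left]
    intro ω h1 h2
    exact h2.1 h1.1
  have zB : ∀ Y : Set (Config E), prob p (sideEvent EB Y) = prob (fun e => if e ∈ EB then p e else 0) Y := fun Y =>
    (CDCutVertex.prob_zeroOff_eq_prob_sideEvent p EB Y).symm
  have p1 := congrArg (prob p) s1
  rw [CDCutVertex.prob_eq_sum_tower p EA EB h.Edisj (connEvent ends s x) (fun T : Config E => clusterInEvent ends x {T : Set V | hv ∈ T} ∩ clusterInEvent ends x {W : Set V | cluster ends T s ∪ W ∈ 𝓤} ∩ clusterInEvent ends x 𝓥)] at p1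
  simp only [zB] at p1
  have p2 := congrArg (prob p) s2
  rw [CDCutVertex.prob_eq_sum_tower p EA EB h.Edisj (connEvent ends s x) (fun _ : Config E => clusterInEvent ends x {T : Set V | hv ∈ T})] at p2
  simp only [zB] at p2
  have p3 := congrArg (prob p) s3
  rw [CDCutVertex.prob_eq_sum_tower p EA EB h.Edisj (connEvent ends s x) (fun T : Config E => clusterInEvent ends x {W : Set V | cluster ends T s ∪ W ∈ 𝓤} ∩ clusterInEvent ends x 𝓥)] at p3
  simp only [zB] at p3
  have p4 := congrArg (prob p) s4
  rw [CDCutVertex.prob_eq_sum_tower p EA EB h.Edisj (connEvent ends s x) (fun T : Config E => clusterInEvent ends x {T : Set V | hv ∈ T} ∩ clusterInEvent ends x {W : Set V | cluster ends T s ∪ W ∈ 𝓤})] at p4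
  simp only [zB] at p4
  have p5 := congrArg (prob p) s5
  rw [CDCutVertex.prob_eq_sum_tower p EA EB h.Edisj (connEvent ends s x) (fun _ : Config E => clusterInEvent ends x 𝓥)] at p5
  simp only [zB] at p5
  have p6 := congrArg (prob p) s6
  rw [CDCutVertex.prob_eq_sum_tower p EA EB h.Edisj (connEvent ends s x) (fun _ : Config E => clusterInEvent ends x {T : Set V | hv ∈ T} ∩ clusterInEvent ends x 𝓥)] at p6
  simp only [zB] at p6
  have p7 := congrArg (prob p) s7
  rw [prob_union_of_disjoint p hdisj7,
    CDCutVertex.prob_eq_sum_tower p EA EB h.Edisj (connEvent ends s x) (fun T : Config E => clusterInEvent ends x {W : Set V | cluster ends T s ∪ W ∈ 𝓤}),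
    ← CDCutVertex.prob_zeroOff_eq_prob_sideEvent p EA] at p7
  simp only [zB] at p7
  have hξ : ∑ ω, weight p ω * (connEvent ends s x).indicator (1 : Config E → R) (restrict EA ω) =
      prob (fun e => if e ∈ EA then p e else 0) (connEvent ends s x) := by
    rw [sum_weight_indicator, CDCutVertex.prob_zeroOff_eq_prob_sideEvent p EA]
  have cst : ∀ c : R, ∑ ω, weight p ω * ((connEvent ends s x).indicator (1 : Config E → R)
      (restrict EA ω) * c) = prob (fun e => if e ∈ EA then p e else 0) (connEvent ends s x) * c := by
    intro c
    rw [← hξ, Finset.sum_mul]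
    exact Finset.sum_congr rfl fun ω _ => by ring
  rw [cst] at p2 p5 p6
  -- the near-side constant as a near-side sum, so that everything is one sum over ω
  have hc : prob (fun e => if e ∈ EA then p e else 0) ((connEvent ends s x)ᶜ ∩ clusterInEvent ends s 𝓤) =
      ∑ ω, weight p ω * ((connEvent ends s x)ᶜ ∩ clusterInEvent ends s 𝓤).indicator
        (1 : Config E → R) (restrict EA ω) := by
    rw [sum_weight_indicator, CDCutVertex.prob_zeroOff_eq_prob_sideEvent p EA]
  rw [p1, p2, p3, p4, p5, p6, p7, hc]
  simp only [Finset.mul_sum, Finset.sum_mul, mul_add, ← Finset.sum_add_distrib, ← Finset.sum_sub_distrib]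
  refine Finset.sum_congr rfl fun ω _ => ?_
  ring

/-- **(T_h) transfers across a cut vertex for an ARBITRARY up-set `𝓤` and a far-side `𝓥`**: if the
far-side (T)-inequality holds, with root `x`, for the up-set `𝓤_T = {W ∣ C_A(s)(T) ∪ W ∈ 𝓤}` of
every near configuration `T` with `s ↔ x` and `C_A(s)(T) ∉ 𝓤`, then (T_h) holds on `G`. -/
theorem t_of_cut_tower (p : E → R) (hp : IsProbVec p) (h : IsCut ends x VA VB EA EB) {s hv : V}
    (hs : s ∈ VA) (hvB : hv ∈ VB) {𝓤 : Set (Set V)} (h𝓤up : IsUpperSet 𝓤) {𝓥 : Set (Set V)}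
    (h𝓥 : ∀ S, S ∈ 𝓥 ↔ S ∩ VB ∈ 𝓥) (h𝓥0 : ∅ ∉ 𝓥)
    (hB : ∀ ω : Config E, Conn ends (restrict EA ω) s x → cluster ends (restrict EA ω) s ∉ 𝓤 →
      prob (fun e => if e ∈ EB then p e else 0) (clusterInEvent ends x {T : Set V | hv ∈ T} ∩ clusterInEvent ends x {W : Set V | cluster ends (restrict EA ω) s ∪ W ∈ 𝓤}) * prob (fun e => if e ∈ EB then p e else 0) (clusterInEvent ends x 𝓥) + prob (fun e => if e ∈ EB then p e else 0) (clusterInEvent ends x {W : Set V | cluster ends (restrict EA ω) s ∪ W ∈ 𝓤}) * prob (fun e => if e ∈ EB then p e else 0) (clusterInEvent ends x {T : Set V | hv ∈ T} ∩ clusterInEvent ends x 𝓥) ≤ prob (fun e => if e ∈ EB then p e else 0) (clusterInEvent ends x {T : Set V | hv ∈ T} ∩ clusterInEvent ends x {W : Set V | cluster ends (restrict EA ω) s ∪ W ∈ 𝓤} ∩ clusterInEvent ends x 𝓥) + prob (fun e => if e ∈ EB then p e else 0) (clusterInEvent ends x {T : Set V | hv ∈ T}) * prob (fun e => if e ∈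 EB then p e else 0) (clusterInEvent ends x {W : Set V | cluster ends (restrict EA ω) s ∪ W ∈ 𝓤} ∩ clusterInEvent ends x 𝓥)) :
    prob p (clusterInEvent ends s {T : Set V | hv ∈ T} ∩ clusterInEvent ends s 𝓤) * prob p (clusterInEvent ends s 𝓥) + prob p (clusterInEvent ends s 𝓤) * prob p (clusterInEvent ends s {T : Set V | hv ∈ T} ∩ clusterInEvent ends s 𝓥) ≤
      prob p (clusterInEvent ends s {T : Set V | hv ∈ T} ∩ clusterInEvent ends s 𝓤 ∩ clusterInEvent ends s 𝓥) + prob p (clusterInEvent ends s {T : Set V | hv ∈ T}) * prob p (clusterInEvent ends s 𝓤 ∩ clusterInEvent ends s 𝓥) := by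
  have hid := t_cut_tower_identity p h hs hvB 𝓤 h𝓥 h𝓥0
  have hpA : IsProbVec (fun e => if e ∈ EA then p e else 0) := CDCutVertex.isProbVec_zeroOff hp EA
  have hpB : IsProbVec (fun e => if e ∈ EB then p e else 0) := CDCutVertex.isProbVec_zeroOff hp EB
  have hξ0 : 0 ≤ prob (fun e => if e ∈ EA then p e else 0) (connEvent ends s x) := prob_nonneg hpA _
  have hξ1 : prob (fun e => if e ∈ EA then p e else 0) (connEvent ends s x) ≤ 1 := prob_le_one hpA _
  have hqe : 0 ≤ prob (fun e => if e ∈ EB then p e else 0) (clusterInEvent ends x {T : Set V | hv ∈ T} ∩ clusterInEvent ends x 𝓥) := prob_nonneg hpB _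
  -- pointwise: the summand dominates the «near cluster already in 𝓤» part
  have hpt : ∀ ω : Config E,
      weight p ω * ((connEvent ends s x ∩ clusterInEvent ends s 𝓤).indicator (1 : Config E → R) (restrict EA ω) *
        ((1 - prob (fun e => if e ∈ EA then p e else 0) (connEvent ends s x)) * prob (fun e => if e ∈ EB then p e else 0) (clusterInEvent ends x {T : Set V | hv ∈ T} ∩ clusterInEvent ends x 𝓥))) ≤
      weight p ω * ((connEvent ends s x).indicator (1 : Config E → R) (restrict EA ω) *
        ((1 - prob (fun e => if e ∈ EA then p e else 0) (connEvent ends s x)) * prob (fun e => if e ∈ EB then p e else 0) (clusterInEvent ends x {T : Set V | hv ∈ T} ∩ clusterInEvent ends x {W : Set V | cluster ends (restrict EA ω) s ∪ W ∈ 𝓤} ∩ clusterInEvent ends x 𝓥) +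
          prob (fun e => if e ∈ EA then p e else 0) (connEvent ends s x) * (prob (fun e => if e ∈ EB then p e else 0) (clusterInEvent ends x {T : Set V | hv ∈ T} ∩ clusterInEvent ends x {W : Set V | cluster ends (restrict EA ω) s ∪ W ∈ 𝓤} ∩ clusterInEvent ends x 𝓥) + prob (fun e => if e ∈ EB then p e else 0) (clusterInEvent ends x {T : Set V | hv ∈ T}) * prob (fun e => if e ∈ EB then p e else 0) (clusterInEvent ends x {W : Set V | cluster ends (restrict EA ω) s ∪ W ∈ 𝓤} ∩ clusterInEvent ends x 𝓥) - prob (fun e => if e ∈ EB then p e else 0) (clusterInEvent ends x {T : Set V | hv ∈ T} ∩ clusterInEvent ends x {W : Set V | cluster ends (restrict EA ω) s ∪ W ∈ 𝓤}) * prob (fun e => if e ∈ EB then p e else 0) (clusterInEvent ends x 𝓥) - prob (fun e => if e ∈ EB then p e else 0) (clusterInEvent ends x {T : Set V | hv ∈ T} ∩ clusterInEvent ends x 𝓥) * prob (fun e => if e ∈ EB then p e else 0) (clusterInEvent ends x {W : Set V | cluster ends (restrict EA ω) s ∪ W ∈ 𝓤})))) := by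
    intro ω
    refine mul_le_mul_of_nonneg_left ?_ (weight_nonneg hp ω)
    by_cases hx : Conn ends (restrict EA ω) s x
    · have hI : (connEvent ends s x).indicator (1 : Config E → R) (restrict EA ω) = 1 :=
        Set.indicator_of_mem (show restrict EA ω ∈ connEvent ends s x from hx) _
      rw [hI, one_mul]
      by_cases hU : cluster ends (restrict EA ω) s ∈ 𝓤
      · have hI2 : (connEvent ends s x ∩ clusterInEvent ends s 𝓤).indicator (1 : Config E → R) (restrict EA ω) = 1 :=
          Set.indicator_of_mem (show restrict EA ω ∈ connEvent ends s x ∩ clusterInEvent ends s 𝓤 from ⟨hx, hU⟩) _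
        have huniv : {W : Set V | cluster ends (restrict EA ω) s ∪ W ∈ 𝓤} = Set.univ :=
          Set.eq_univ_of_forall fun W => h𝓤up Set.subset_union_left hU
        have hcu : clusterInEvent ends x {W : Set V | cluster ends (restrict EA ω) s ∪ W ∈ 𝓤} =
            Set.univ := by
          rw [huniv]; ext ω'; simp only [mem_clusterInEvent, Set.mem_univ]
        rw [hI2, one_mul, hcu, Set.inter_univ, Set.univ_inter, prob_univ]
        apply le_of_eq
        ring
      · have hI2 : (connEvent ends s x ∩ clusterInEvent ends s 𝓤).indicator (1 : Config E → R) (restrict EA ω) = 0 :=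
          Set.indicator_of_notMem (show restrict EA ω ∉ connEvent ends s x ∩ clusterInEvent ends s 𝓤 from
            fun hh => hU hh.2) _
        rw [hI2, zero_mul]
        have hT := hB ω hx hU
        have hq : 0 ≤ prob (fun e => if e ∈ EB then p e else 0) (clusterInEvent ends x {T : Set V | hv ∈ T} ∩ clusterInEvent ends x {W : Set V | cluster ends (restrict EA ω) s ∪ W ∈ 𝓤} ∩ clusterInEvent ends x 𝓥) := prob_nonneg hpB _
        nlinarith [mul_nonneg (sub_nonneg.2 hξ1) hq, mul_nonneg hξ0 (sub_nonneg.2 hT)]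
    · have hI : (connEvent ends s x).indicator (1 : Config E → R) (restrict EA ω) = 0 :=
        Set.indicator_of_notMem (show restrict EA ω ∉ connEvent ends s x from hx) _
      have hI2 : (connEvent ends s x ∩ clusterInEvent ends s 𝓤).indicator (1 : Config E → R) (restrict EA ω) = 0 :=
        Set.indicator_of_notMem (show restrict EA ω ∉ connEvent ends s x ∩ clusterInEvent ends s 𝓤 from
          fun hh => hx hh.1) _
      rw [hI, hI2]
      simp
  have hsum := Finset.sum_le_sum (fun ω (_ : ω ∈ Finset.univ) => hpt ω)
  -- the lower bound is a near-side probability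
  have hlow : ∑ ω, weight p ω * ((connEvent ends s x ∩ clusterInEvent ends s 𝓤).indicator (1 : Config E → R)
      (restrict EA ω) * ((1 - prob (fun e => if e ∈ EA then p e else 0) (connEvent ends s x)) * prob (fun e => if e ∈ EB then p e else 0) (clusterInEvent ends x {T : Set V | hv ∈ T} ∩ clusterInEvent ends x 𝓥))) =
      prob (fun e => if e ∈ EA then p e else 0) (connEvent ends s x ∩ clusterInEvent ends s 𝓤) * ((1 - prob (fun e => if e ∈ EA then p e else 0) (connEvent ends s x)) * prob (fun e => if e ∈ EB then p e else 0) (clusterInEvent ends x {T : Set V | hv ∈ T} ∩ clusterInEvent ends x 𝓥)) := by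
    rw [CDCutVertex.prob_zeroOff_eq_prob_sideEvent p EA (connEvent ends s x ∩ clusterInEvent ends s 𝓤),
      ← sum_weight_indicator p (connEvent ends s x ∩ clusterInEvent ends s 𝓤), Finset.sum_mul]
    exact Finset.sum_congr rfl fun ω _ => by ring
  rw [hlow] at hsum
  -- Harris on the near side and the complement split
  have hH : prob (fun e => if e ∈ EA then p e else 0) (connEvent ends s x) * prob (fun e => if e ∈ EA then p e else 0) (clusterInEvent ends s 𝓤) ≤ prob (fun e => if e ∈ EA then p e else 0) (connEvent ends s x ∩ clusterInEvent ends s 𝓤) :=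
    prob_mul_prob_le_prob_inter hpA (isUpperSet_connEvent ends s x)
      (isUpperSet_clusterInEvent ends s h𝓤up)
  have hsplit : prob (fun e => if e ∈ EA then p e else 0) (clusterInEvent ends s 𝓤 ∩ connEvent ends s x) + prob (fun e => if e ∈ EA then p e else 0) (clusterInEvent ends s 𝓤 ∩ (connEvent ends s x)ᶜ) =
      prob (fun e => if e ∈ EA then p e else 0) (clusterInEvent ends s 𝓤) := prob_inter_add_prob_inter_compl _ _ _
  rw [Set.inter_comm, Set.inter_comm (clusterInEvent ends s 𝓤) ((connEvent ends s x)ᶜ)] at hsplit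
  have hcov : 0 ≤ prob (fun e => if e ∈ EA then p e else 0) (connEvent ends s x ∩ clusterInEvent ends s 𝓤) - prob (fun e => if e ∈ EA then p e else 0) (connEvent ends s x) * prob (fun e => if e ∈ EA then p e else 0) (clusterInEvent ends s 𝓤) := sub_nonneg.2 hH
  have hkey : 0 ≤ prob (fun e => if e ∈ EA then p e else 0) (connEvent ends s x ∩ clusterInEvent ends s 𝓤) * ((1 - prob (fun e => if e ∈ EA then p e else 0) (connEvent ends s x)) * prob (fun e => if e ∈ EB then p e else 0) (clusterInEvent ends x {T : Set V | hv ∈ T} ∩ clusterInEvent ends x 𝓥)) -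
      prob (fun e => if e ∈ EA then p e else 0) (connEvent ends s x) * prob (fun e => if e ∈ EB then p e else 0) (clusterInEvent ends x {T : Set V | hv ∈ T} ∩ clusterInEvent ends x 𝓥) * prob (fun e => if e ∈ EA then p e else 0) ((connEvent ends s x)ᶜ ∩ clusterInEvent ends s 𝓤) := by
    have : prob (fun e => if e ∈ EA then p e else 0) ((connEvent ends s x)ᶜ ∩ clusterInEvent ends s 𝓤) = prob (fun e => if e ∈ EA then p e else 0) (clusterInEvent ends s 𝓤) - prob (fun e => if e ∈ EA then p e else 0) (connEvent ends s x ∩ clusterInEvent ends s 𝓤) := by linarith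
    rw [this]
    nlinarith [mul_nonneg hqe hcov]
  linarith [hid, hsum, hkey]

end Main

end TCutVertexTower

end Summit.Ventures.PercRepro2
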